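import Summits.AtomisticToContinuum.FouriersLaw.Theorems.OddSectorIrreversibilityCorrectorTheory
import Summits.AtomisticToContinuum.FouriersLaw.Theorems.OddSectorIrreversibilityResponseDensityDetailedBalance

/-!
# Tap duality for the odd Kubo corrector, I: Poisson problems with decaying smooth sources

Helper file 1 (`--supports` stmt-AtomisticToContinuum-9121) for stub `stub_tapDualityOddCorrector`
(S_A) of line `tap-duality-gk-time` (crux `BondHeatUncertainty.ExtensiveSnapshotIrreversibility`).
Pinned anharmonic chain `P = pinnedChain ω₂ lam β γ` (all parameters `> 0`), `N ≥ 1`, both baths at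
`T > 0`, equilibrium kernels `P_t = P.transitionKernel N T T t`, Gibbs weight `ρ = e^{-H/T}`.

* `poisson_smooth_of_decay` — for a SMOOTH source `k` with `|k| ≤ K e^{ϑH}` (`0 < ϑ < 1/T`) and
  DECAYING forecasts `|P_t k(z)| ≤ M e^{ϑH(z)} e^{-ct}`, the forward integral `∫₀^∞ P_t k dt` agrees
  Lebesgue-a.e. with a smooth `v`, `L_{T,T} v = -k` pointwise and `|v| ≤ K' e^{ϑH}` (the proof of
  `Corrector.corrector_smooth`, run with `k` in place of the total current: the tree's hypoelliptic
  Poisson pipeline `PlainForwardField.*`, Hörmander, Green).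
* `forecast_decay_of_odd` — forecasts of continuous observables ODD under the momentum flip decay:
  `|P_t g(z)| ≤ M e^{ϑH(z)} e^{-ct}` (CEHR (2.5) at equilibrium, `μ_T(g) = 0` by oddness).
* `pairing_fubini` — for continuous `f = O(e^{ϑH})` and decaying forecasts of `g` (`2ϑ < 1/T`):
  `t ↦ ∫ f · P_t g ρ` is integrable on `(0, ∞)` and `∫₀^∞ ∫ f · P_t g ρ dt = ∫ f (∫₀^∞ P_t g dt) ρ`.
* `integral_odd_pairing_symm` — for continuous odd `f, g = O(e^{ϑH})`:
  `∫ f · P_t g ρ = ∫ g · P_t f ρ` (kernel detailed balance `pinnedChain_detailedBalance` + oddness).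

References: Cuneo–Eckmann–Hairer–Rey-Bellet 2018, Thm 2.13; L. Hörmander, Acta Math. 119 (1967),
Thm 1.1. No definitions, no named facts; nothing here closes the item.
-/

noncomputable section

open MeasureTheory ProbabilityTheory Filter Topology Set Function
open scoped NNReal ENNReal ContDiff
open Literature.MathematicalPhysics.KineticTheory.HeatConduction
open Literature.MathematicalPhysics.KineticTheory Literature.Analysis.Distribution OscillatorChain
open Summit.AtomisticToContinuum.FouriersLaw.Theorems.SuperadditiveResistance.PlainForwardField
open Summit.AtomisticToContinuum.FouriersLaw.Theorems.SubdiffusiveBondHeat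
open Summit.AtomisticToContinuum.FouriersLaw.Theorems.OddSectorIrreversibility
open Summit.AtomisticToContinuum.FouriersLaw.Theorems.OddSectorIrreversibility.Corrector

namespace Summit.AtomisticToContinuum.FouriersLaw.Theorems.ExtensiveSnapshotIrreversibility.TapDuality

variable {N : ℕ}

section Pinned

variable {ω₂ lam β γ : ℝ} (hω : 0 < ω₂) (hl : 0 < lam) (hβ : 0 < β) (hγ : 0 < γ) {T : ℝ} (hT : 0 < T)
  (hN : 0 < N)
include hω hl hβ hγ hT hN

/-- **Smooth solutions of the Poisson equation for decaying smooth sources.** For the pinned chain at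
equilibrium temperature `T` (`N ≥ 1`), a smooth `k` with `|k| ≤ K e^{ϑH}` (`0 < ϑ < 1/T`) whose
forecasts decay, `|P_t k(z)| ≤ M e^{ϑH(z)} e^{-ct}` (`c > 0`): there is a smooth `v` with
`∫_{(0,∞)} P_t k dt = v` Lebesgue-a.e., `L_{T,T} v = -k` pointwise, and `|v| ≤ K' e^{ϑH}` for some
`K' ≥ 0` (the proof of `Corrector.corrector_smooth` for a general source).
[cite: CuneoEckmannHairerReyBellet2018, Thm 2.13] [cite: Hormander1967, Thm 1.1] -/
theorem poisson_smooth_of_decay {ϑ K M c : ℝ} (hϑ : 0 < ϑ) (hϑT : ϑ < 1 / T) (hc : 0 < c)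
    {k : PhaseSpace N → ℝ} (hk : ContDiff ℝ ∞ k)
    (hkb : ∀ y, |k y| ≤ K * Real.exp (ϑ * (pinnedChain ω₂ lam β γ).hamiltonian N y))
    (hdecay : ∀ (t : ℝ≥0) (z : PhaseSpace N),
      |∫ y, k y ∂((pinnedChain ω₂ lam β γ).transitionKernel N T T t z)| ≤
        M * Real.exp (ϑ * (pinnedChain ω₂ lam β γ).hamiltonian N z) * Real.exp (-c * t)) :
    ∃ v : PhaseSpace N → ℝ, ContDiff ℝ ∞ v ∧
      (fun x => ∫ t in Ioi (0 : ℝ), ∫ y, k y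
        ∂((pinnedChain ω₂ lam β γ).transitionKernel N T T t.toNNReal x)) =ᵐ[volume] v ∧
      (∀ x, (pinnedChain ω₂ lam β γ).generator N T T v x = -k x) ∧
      ∃ K' : ℝ, 0 ≤ K' ∧
        ∀ x, |v x| ≤ K' * Real.exp (ϑ * (pinnedChain ω₂ lam β γ).hamiltonian N x) := by
  haveI := isAddHaarMeasure_volume_phaseSpace N
  set P := pinnedChain ω₂ lam β γ with hP
  have hU : ContDiff ℝ ∞ P.U := pinnedChain_contDiff_U ω₂ lam β γ
  have hV : ContDiff ℝ ∞ P.V := pinnedChain_contDiff_V ω₂ lam β γ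
  have hγ' : P.γ = γ := rfl
  have hγT : 0 ≤ P.γ * T := by rw [hγ']; positivity
  have hkc : Continuous k := hk.continuous
  set Hm := P.hamiltonian N with hHm
  have hHc : Continuous Hm := pinnedChain_continuous_hamiltonian ω₂ lam β γ N
  -- kernels: the chain pipeline's `transitionKernel` is the model-free `langevinKernel`
  have hker : ∀ t, P.langevinKernel N T T t = P.transitionKernel N T T t :=
    fun t => pinnedChain_langevinKernel_eq_transitionKernel N T T hω hl.le hβ.le hγ.le t
  have hdecay' : ∀ (t : ℝ≥0) (z : PhaseSpace N), |∫ y, k y ∂(P.langevinKernel N T T t z)| ≤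
      M * Real.exp (ϑ * Hm z) * Real.exp (-c * t) := fun t z => by
    rw [hker]; exact hdecay t z
  have hM : 0 ≤ M := by
    have h0 : 0 ≤ M * Real.exp (ϑ * Hm 0) * Real.exp (-c * ((0 : ℝ≥0) : ℝ)) :=
      (abs_nonneg _).trans (hdecay 0 0)
    have h1 : 0 ≤ M * Real.exp (ϑ * Hm 0) := nonneg_of_mul_nonneg_left h0 (Real.exp_pos _)
    exact nonneg_of_mul_nonneg_left h1 (Real.exp_pos _)
  -- the candidate and its a-priori bound
  set g₀ : PhaseSpace N → ℝ := fun x => ∫ t in Ioi (0 : ℝ),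
    ∫ y, k y ∂(P.langevinKernel N T T t.toNNReal x) with hg₀
  have hg₀m : StronglyMeasurable g₀ := stronglyMeasurable_forwardIntegral hω hl.le hβ.le hγ.le hkc
  have hIpos : 0 ≤ ∫ t in Ioi (0 : ℝ), Real.exp (-c * t) :=
    setIntegral_nonneg measurableSet_Ioi fun t _ => (Real.exp_pos _).le
  set K' : ℝ := M * ∫ t in Ioi (0 : ℝ), Real.exp (-c * t) with hK'
  have hK'0 : 0 ≤ K' := mul_nonneg hM hIpos
  have hg₀b : ∀ x, |g₀ x| ≤ K' * Real.exp (ϑ * Hm x) := fun x =>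
    abs_forwardIntegral_le k hc hdecay' x
  set B : PhaseSpace N → ℝ := fun x => K' * Real.exp (ϑ * Hm x) with hB
  have hBc : Continuous B := by rw [hB]; fun_prop
  have hg₀B : ∀ x, ‖g₀ x‖ ≤ ‖B x‖ := fun x => by
    rw [Real.norm_eq_abs, Real.norm_eq_abs]
    exact (hg₀b x).trans (le_abs_self _)
  have hg₀loc : LocallyIntegrable g₀ volume :=
    hBc.locallyIntegrable.mono hg₀m.aestronglyMeasurable (Eventually.of_forall hg₀B)
  -- the Poisson equation in `𝓓'`
  have hweak₀ : ∀ φ : PhaseSpace N → ℝ, ContDiff ℝ ∞ φ → HasCompactSupport φ →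
      ∫ x, g₀ x * hormanderTranspose (P.drift N) (P.bathField hN T T) (fun _ => 0) φ x =
        ∫ x, (-k x) * φ x := by
    intro φ hφ hφc
    have h := integral_transpose_mul_forwardIntegral hω hl.le hβ.le hγ.le hN hT hϑ hϑT hc hk hkb
      hdecay' hφ hφc
    calc ∫ x, g₀ x * hormanderTranspose (P.drift N) (P.bathField hN T T) (fun _ => 0) φ x
        = ∫ x, (sdeGenerator (fun y => -P.drift N y) (P.bathVecL N T) (P.bathVecR N T) φ x +
            2 * γ * φ x) * g₀ x := by
          refine integral_congr_ae (ae_of_all _ fun x => ?_)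
          dsimp only
          rw [hormanderTranspose_generatorFamily_eq_revGenerator P hU hV hN hγT hγT hφ x, hγ', mul_comm]
      _ = -∫ x, φ x * k x := h
      _ = ∫ x, (-k x) * φ x := by
          rw [← integral_neg]
          exact integral_congr_ae (ae_of_all _ fun x => by ring)
  -- hypoelliptic regularity and the classical equation
  obtain ⟨v, hv, hae⟩ := exists_smooth_ae_eq_of_weak_poisson hβ.le hγ hN hT hg₀loc hk.neg hweak₀
  have hweak : ∀ φ : PhaseSpace N → ℝ, ContDiff ℝ ∞ φ → HasCompactSupport φ →
      ∫ x, v x * hormanderTranspose (P.drift N) (P.bathField hN T T) (fun _ => 0) φ x =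
        ∫ x, (-k x) * φ x := by
    intro φ hφ hφc
    rw [← hweak₀ φ hφ hφc]
    refine integral_congr_ae ?_
    filter_upwards [hae] with x hx
    rw [hx]
  have hclass : ∀ x, P.generator N T T v x = -k x :=
    generator_eq_of_weak_poisson P hU hV hN hγT hγT hv hkc.neg hweak
  have hg₀' : (fun x => ∫ t in Ioi (0 : ℝ), ∫ y, k y ∂(P.transitionKernel N T T t.toNNReal x)) = g₀ := by
    funext x; simp only [hg₀, hker]
  refine ⟨v, hv, by rw [hg₀']; exact hae, hclass, K', hK'0, fun x => ?_⟩
  have hael : ∀ᵐ y ∂(volume : Measure (PhaseSpace N)), |v y| ≤ K' * Real.exp (ϑ * Hm y) := by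
    filter_upwards [hae] with y hy
    rw [← hy]; exact hg₀b y
  exact le_of_ae_le_of_continuous (continuous_abs.comp hv.continuous) (by fun_prop) hael x

/-- **Forecasts of odd observables decay.** For a continuous `g` with `g(q,-p) = -g(q,p)` and
`|g| ≤ K e^{ϑH}` (`0 < ϑ < 1/T`, `K ≥ 0`): `|P_t g(z)| ≤ M e^{ϑH(z)} e^{-ct}` for some `M ≥ 0`, `c > 0`
(CEHR (2.5) in the `e^{ϑH}`-weighted norm, and `μ_T(g) = 0` by momentum reversal).
[cite: CuneoEckmannHairerReyBellet2018, Thm 2.13 eq. (2.5)] -/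
theorem forecast_decay_of_odd {ϑ K : ℝ} (hϑ : 0 < ϑ) (hϑT : ϑ < 1 / T) (hK : 0 ≤ K)
    {g : PhaseSpace N → ℝ} (hg : Continuous g) (hgodd : ∀ x : PhaseSpace N, g (x.1, -x.2) = -g x)
    (hgb : ∀ y, |g y| ≤ K * Real.exp (ϑ * (pinnedChain ω₂ lam β γ).hamiltonian N y)) :
    ∃ M c : ℝ, 0 ≤ M ∧ 0 < c ∧ ∀ (t : ℝ≥0) (z : PhaseSpace N),
      |∫ y, g y ∂((pinnedChain ω₂ lam β γ).transitionKernel N T T t z)| ≤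
        M * Real.exp (ϑ * (pinnedChain ω₂ lam β γ).hamiltonian N z) * Real.exp (-c * t) := by
  obtain ⟨K₀, c, hK₀, hc, hb⟩ := pinnedChain_harris_bound hω hl.le hβ hγ hN hT hϑ hϑT
  refine ⟨K₀ * K, c, by positivity, hc, fun t z => ?_⟩
  have h := hb z t g hg K hK hgb
  have h0 : ∫ y, g y ∂((pinnedChain ω₂ lam β γ).gibbsMeasure N T) = 0 := by
    rw [(pinnedChain ω₂ lam β γ).integral_gibbsMeasure,
      integral_mul_gibbsDensity_eq_zero_of_odd _ N T hgodd, mul_zero]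
  rwa [h0, sub_zero] at h

omit hγ hN in
/-- **Fubini for forecast pairings.** For continuous `f` with `|f| ≤ A e^{ϑH}`, a continuous `g` with
decaying forecasts `|P_t g(z)| ≤ M e^{ϑH(z)} e^{-ct}` (`c > 0`, `2ϑ < 1/T`), and `ρ = e^{-H/T}`:
`t ↦ ∫ f · P_t g ρ dx` is integrable on `(0, ∞)` and
`∫_{(0,∞)} ∫ f · P_t g ρ dx dt = ∫ f · (∫_{(0,∞)} P_t g dt) ρ dx` (domination by
`A M e^{2ϑH} ρ e^{-ct} ∈ L¹`; joint measurability of the forecasts). [folklore] -/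
theorem pairing_fubini (hγ : 0 ≤ γ) {ϑ A M c : ℝ} (h2ϑ : 2 * ϑ < 1 / T) (hc : 0 < c)
    {f g : PhaseSpace N → ℝ} (hf : Continuous f) (hg : Continuous g)
    (hfb : ∀ y, |f y| ≤ A * Real.exp (ϑ * (pinnedChain ω₂ lam β γ).hamiltonian N y))
    (hdecay : ∀ (t : ℝ≥0) (z : PhaseSpace N),
      |∫ y, g y ∂((pinnedChain ω₂ lam β γ).transitionKernel N T T t z)| ≤
        M * Real.exp (ϑ * (pinnedChain ω₂ lam β γ).hamiltonian N z) * Real.exp (-c * t)) :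
    IntegrableOn (fun t : ℝ => ∫ z, f z *
        (∫ y, g y ∂((pinnedChain ω₂ lam β γ).transitionKernel N T T t.toNNReal z)) *
          (pinnedChain ω₂ lam β γ).gibbsDensity N T z) (Ioi 0) ∧
    ∫ t in Ioi (0 : ℝ), ∫ z, f z *
        (∫ y, g y ∂((pinnedChain ω₂ lam β γ).transitionKernel N T T t.toNNReal z)) *
          (pinnedChain ω₂ lam β γ).gibbsDensity N T z =
      ∫ z, f z * (∫ t in Ioi (0 : ℝ),
        ∫ y, g y ∂((pinnedChain ω₂ lam β γ).transitionKernel N T T t.toNNReal z)) *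
          (pinnedChain ω₂ lam β γ).gibbsDensity N T z := by
  set P := pinnedChain ω₂ lam β γ with hP
  set Hm := P.hamiltonian N with hHm
  set ρ := P.gibbsDensity N T with hρ
  have hHc : Continuous Hm := pinnedChain_continuous_hamiltonian ω₂ lam β γ N
  have hρc : Continuous ρ := pinnedChain_continuous_gibbsDensity ω₂ lam β γ N T
  have hρ0 : ∀ x, 0 < ρ x := fun x => P.gibbsDensity_pos N T x
  have hker : ∀ t, P.langevinKernel N T T t = P.transitionKernel N T T t :=
    fun t => pinnedChain_langevinKernel_eq_transitionKernel N T T hω hl.le hβ.le hγ t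
  have hM : 0 ≤ M := by
    have h0 : 0 ≤ M * Real.exp (ϑ * Hm 0) * Real.exp (-c * ((0 : ℝ≥0) : ℝ)) :=
      (abs_nonneg _).trans (hdecay 0 0)
    have h1 : 0 ≤ M * Real.exp (ϑ * Hm 0) := nonneg_of_mul_nonneg_left h0 (Real.exp_pos _)
    exact nonneg_of_mul_nonneg_left h1 (Real.exp_pos _)
  -- the forecasts `U t z = P_{t⁺} g (z)`: joint measurability and decay
  set U : ℝ → PhaseSpace N → ℝ := fun t z => ∫ y, g y ∂(P.transitionKernel N T T t.toNNReal z) with hU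
  have hUm : StronglyMeasurable (Function.uncurry U) := by
    have h : StronglyMeasurable fun q : ℝ × PhaseSpace N =>
        ∫ y, g y ∂(P.langevinKernel N T T q.1.toNNReal q.2) :=
      stronglyMeasurable_act_uncurry hω hl.le hβ.le hγ (T := T) hg
    simp only [hker] at h
    exact h
  have hUb : ∀ t z, |U t z| ≤ M * Real.exp (ϑ * Hm z) * Real.exp (-c * t) := by
    intro t z
    have h := hdecay t.toNNReal z
    refine h.trans (mul_le_mul_of_nonneg_left (Real.exp_le_exp.2 ?_) (mul_nonneg hM (Real.exp_pos _).le))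
    have : t ≤ (t.toNNReal : ℝ) := Real.le_coe_toNNReal t
    nlinarith
  -- the integrand on `(0,∞) × Ω` and its majorant
  set F : ℝ → PhaseSpace N → ℝ := fun t z => f z * U t z * ρ z with hF
  have hFm : StronglyMeasurable (Function.uncurry F) := by
    have h1 : StronglyMeasurable fun q : ℝ × PhaseSpace N => f q.2 :=
      (hf.comp continuous_snd).stronglyMeasurable
    have h3 : StronglyMeasurable fun q : ℝ × PhaseSpace N => ρ q.2 :=
      (hρc.comp continuous_snd).stronglyMeasurable
    exact (h1.mul hUm).mul h3
  have h2int : Integrable (fun z => Real.exp (2 * ϑ * Hm z) * ρ z) :=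
    pinnedChain_integrable_exp_mul_gibbsDensity hω hl.le hβ.le γ N hT h2ϑ
  have hGint : Integrable (fun z => |f z| * (M * Real.exp (ϑ * Hm z)) * ρ z) := by
    refine (h2int.const_mul (A * M)).mono' ?_ (Eventually.of_forall fun z => ?_)
    · exact (((continuous_abs.comp hf).mul (continuous_const.mul (by fun_prop))).mul
        hρc).aestronglyMeasurable
    · have hez := (Real.exp_pos (ϑ * Hm z)).le
      have hρz := (hρ0 z).le
      have hnn : 0 ≤ |f z| * (M * Real.exp (ϑ * Hm z)) * ρ z :=
        mul_nonneg (mul_nonneg (abs_nonneg _) (mul_nonneg hM hez)) hρz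
      have e2 : Real.exp (2 * ϑ * Hm z) = Real.exp (ϑ * Hm z) * Real.exp (ϑ * Hm z) := by
        rw [← Real.exp_add]; ring_nf
      rw [Real.norm_of_nonneg hnn, e2]
      calc |f z| * (M * Real.exp (ϑ * Hm z)) * ρ z
          ≤ (A * Real.exp (ϑ * Hm z)) * (M * Real.exp (ϑ * Hm z)) * ρ z :=
            mul_le_mul_of_nonneg_right (mul_le_mul_of_nonneg_right (hfb z) (mul_nonneg hM hez)) hρz
        _ = A * M * (Real.exp (ϑ * Hm z) * Real.exp (ϑ * Hm z) * ρ z) := by ring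
  have hprod : Integrable (Function.uncurry F) ((volume.restrict (Ioi (0 : ℝ))).prod volume) := by
    have hg' : Integrable (fun q : ℝ × PhaseSpace N => Real.exp (-c * q.1) *
        (|f q.2| * (M * Real.exp (ϑ * Hm q.2)) * ρ q.2)) ((volume.restrict (Ioi (0 : ℝ))).prod volume) :=
      Integrable.mul_prod (exp_neg_integrableOn_Ioi 0 hc) hGint
    refine hg'.mono' hFm.aestronglyMeasurable (Eventually.of_forall fun q => ?_)
    rcases q with ⟨t, z⟩
    rw [Real.norm_eq_abs]
    show |f z * U t z * ρ z| ≤ Real.exp (-c * t) * (|f z| * (M * Real.exp (ϑ * Hm z)) * ρ z)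
    rw [abs_mul, abs_mul, abs_of_nonneg (hρ0 z).le]
    have hU' := hUb t z
    have hf0 := abs_nonneg (f z)
    have hρz := (hρ0 z).le
    calc |f z| * |U t z| * ρ z ≤ |f z| * (M * Real.exp (ϑ * Hm z) * Real.exp (-c * t)) * ρ z :=
          mul_le_mul_of_nonneg_right (mul_le_mul_of_nonneg_left hU' hf0) hρz
      _ = Real.exp (-c * t) * (|f z| * (M * Real.exp (ϑ * Hm z)) * ρ z) := by ring
  refine ⟨?_, ?_⟩
  · -- integrability of the time slices
    exact hprod.integral_prod_left
  · -- Fubini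
    have hswap := integral_integral_swap hprod
    calc ∫ t in Ioi (0 : ℝ), ∫ z, F t z = ∫ z, ∫ t in Ioi (0 : ℝ), F t z := hswap
      _ = ∫ z, f z * (∫ t in Ioi (0 : ℝ), U t z) * ρ z := by
          refine integral_congr_ae (ae_of_all _ fun z => ?_)
          show ∫ t in Ioi (0 : ℝ), f z * U t z * ρ z = f z * (∫ t in Ioi (0 : ℝ), U t z) * ρ z
          rw [integral_mul_const, integral_const_mul]

omit hω hl hβ hγ hT hN in
/-- **Symmetry of forecast pairings of odd observables.** For continuous `f, g` odd under the momentum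
flip with `|f|, |g| = O(e^{ϑH})` (`0 < ϑ`, `2ϑ < 1/T`) and `t ≥ 0`:
`∫ f · P_t g ρ dx = ∫ g · P_t f ρ dx` — kernel detailed balance `∫ ρ G P_tF = ∫ ρ (F∘Θ) P_t(G∘Θ)`
(`pinnedChain_detailedBalance`) and `F∘Θ = -F`, `G∘Θ = -G`. [folklore] -/
theorem integral_odd_pairing_symm (hω : 0 < ω₂) (hl : 0 ≤ lam) (hβ : 0 ≤ β) (hγ : 0 < γ) (hN : 0 < N)
    (hT : 0 < T) {ϑ A B : ℝ} (hϑ : 0 < ϑ) (h2ϑ : 2 * ϑ < 1 / T)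
    {f g : PhaseSpace N → ℝ} (hf : Continuous f) (hg : Continuous g)
    (hfodd : ∀ x : PhaseSpace N, f (x.1, -x.2) = -f x)
    (hgodd : ∀ x : PhaseSpace N, g (x.1, -x.2) = -g x)
    (hfb : ∀ y, |f y| ≤ A * Real.exp (ϑ * (pinnedChain ω₂ lam β γ).hamiltonian N y))
    (hgb : ∀ y, |g y| ≤ B * Real.exp (ϑ * (pinnedChain ω₂ lam β γ).hamiltonian N y)) (t : ℝ≥0) :
    ∫ z, f z * (∫ y, g y ∂((pinnedChain ω₂ lam β γ).transitionKernel N T T t z)) *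
        (pinnedChain ω₂ lam β γ).gibbsDensity N T z =
      ∫ z, g z * (∫ y, f y ∂((pinnedChain ω₂ lam β γ).transitionKernel N T T t z)) *
        (pinnedChain ω₂ lam β γ).gibbsDensity N T z := by
  have h := pinnedChain_detailedBalance hω hl hβ hγ hN hT hϑ h2ϑ hg hf hgb hfb t
  have hρe : ∀ x : PhaseSpace N, Real.exp (-1 / T * (pinnedChain ω₂ lam β γ).hamiltonian N x) =
      (pinnedChain ω₂ lam β γ).gibbsDensity N T x := fun x => by
    show _ = Real.exp (-((pinnedChain ω₂ lam β γ).hamiltonian N x) / T)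
    congr 1; ring
  simp only [hρe, hgodd, hfodd, integral_neg, mul_neg, neg_mul, neg_neg] at h
  calc ∫ z, f z * (∫ y, g y ∂((pinnedChain ω₂ lam β γ).transitionKernel N T T t z)) *
        (pinnedChain ω₂ lam β γ).gibbsDensity N T z
      = ∫ x, (pinnedChain ω₂ lam β γ).gibbsDensity N T x * f x *
          (∫ y, g y ∂((pinnedChain ω₂ lam β γ).transitionKernel N T T t x)) :=
        integral_congr_ae (ae_of_all _ fun x => by ring)
    _ = ∫ x, (pinnedChain ω₂ lam β γ).gibbsDensity N T x * g x *
          (∫ y, f y ∂((pinnedChain ω₂ lam β γ).transitionKernel N T T t x)) := h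
    _ = _ := integral_congr_ae (ae_of_all _ fun x => by ring)

end Pinned

/-! ## Registered helper stub -/

/-- **Registered helper stub of this file** (`helper_tapDualityPoissonSmooth`, sub-goal of
stub `stub_tapDualityOddCorrector` of crux stmt-AtomisticToContinuum-9121): smooth classical solutions
of `L v = -k` for decaying smooth sources (= `poisson_smooth_of_decay`).
[cite: CuneoEckmannHairerReyBellet2018, Thm 2.13] [cite: Hormander1967, Thm 1.1] -/
theorem helper_tapDualityPoissonSmooth : ∀ ω₂ lam β γ : ℝ, 0 < ω₂ → 0 < lam → 0 < β → 0 < γ → ∀ (N : ℕ), 0 < N → ∀ T : ℝ, 0 < T → ∀ ϑ K M c : ℝ, 0 < ϑ → ϑ < 1 / T → 0 < c → ∀ k : PhaseSpace N → ℝ, ContDiff ℝ (⊤ : ℕ∞) k → (∀ y, |k y| ≤ K * Real.exp (ϑ * (pinnedChain ω₂ lam β γ).hamiltonian N y)) → (∀ (t : ℝ≥0) (z : PhaseSpace N), |∫ y, k y ∂((pinnedChain ω₂ lam β γ).transitionKernel N T T t z)| ≤ M * Real.exp (ϑ * (pinnedChain ω₂ lam β γ).hamiltonian N z) * Real.exp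 (-c * t)) → ∃ v : PhaseSpace N → ℝ, ContDiff ℝ (⊤ : ℕ∞) v ∧ (fun x => ∫ t in Set.Ioi (0 : ℝ), ∫ y, k y ∂((pinnedChain ω₂ lam β γ).transitionKernel N T T t.toNNReal x)) =ᵐ[volume] v ∧ (∀ x, (pinnedChain ω₂ lam β γ).generator N T T v x = -k x) ∧ ∃ K' : ℝ, 0 ≤ K' ∧ ∀ x, |v x| ≤ K' * Real.exp (ϑ * (pinnedChain ω₂ lam β γ).hamiltonian N x) :=
  fun _ _ _ _ hω hl hβ hγ _ hN _ hT _ _ _ _ hϑ hϑT hc _ hk hkb hdecay =>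
    poisson_smooth_of_decay hω hl hβ hγ hT hN hϑ hϑT hc hk hkb hdecay

end Summit.AtomisticToContinuum.FouriersLaw.Theorems.ExtensiveSnapshotIrreversibility.TapDuality

end
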